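import Mathlib.Data.Complex.Basic
import Summits.MatrixMultiplication.MatrixMultiplication.Theses.SemilatticeSTPP
import Literature.Computability.AlgebraicComplexity.GroupAlgebraTensor
import Literature.Computability.AlgebraicComplexity.TensorRestrictionRank
import Literature.Computability.AlgebraicComplexity.SchoenhageTau

/-!
# `TPPRestriction` — a monoid-TPP family is a restriction `⊕ᵢ ⟨aᵢ,bᵢ,cᵢ⟩ ≤ T_M`

Route `MatrixMultiplication/SemilatticeSTPP`, item `stmt-MatrixMultiplication-5973` (support):
for ANY finite monoid `M` and coordinate maps `α : Σ i, [aᵢ]×[bᵢ] → M`, `β : Σ i, [bᵢ]×[cᵢ] → M`,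
`γ : Σ i, [aᵢ]×[cᵢ] → M` with the monoid triple-product property in iff-form
`α x · β y = γ z ↔ (z.1 = x.1 = y.1 ∧ z = (s,u), x = (s,t), y = (t,u))`, the direct sum of matrix
multiplication tensors `matMulDirectSum ℂ a b c` is a restriction of the structure tensor
`groupTensor ℂ M` of `ℂ[M]` (Cohn–Umans 2003, Thm. 2.3, without inverses: the iff-form already says
that the pulled-back multiplication table IS the indicator of `⊕ᵢ ⟨aᵢ,bᵢ,cᵢ⟩`).

Proof.  `groupTensor ℂ M (γ z) (α x) (β y) = [α x · β y = γ z] = [block/row/inner/column indices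
match] = matMulDirectSum ℂ a b c z x y` pointwise (`if_congr` along the hypothesis), so the direct
sum is literally the precomposition of `T_M` with `(γ, α, β)`, which is a restriction
(`tensorRestrictsTo_precomp`, the `0/1` matrices of `γ, α, β`).
-/

-- single-conjunct summit: the mandated namespace `Summit.MatrixMultiplication.MatrixMultiplication.…`
-- repeats `MatrixMultiplication` (summit = sub-problem), which `linter.dupNamespace` would flag.
set_option linter.dupNamespace false

namespace Summit.MatrixMultiplication.MatrixMultiplication.Theorems

open Literature.Computability.AlgebraicComplexity

/-- **Pointwise form of the monoid-TPP embedding**: under the iff-form triple product property,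
the multiplication table of `M` pulled back along `(γ, α, β)` is the direct sum of matrix
multiplication tensors, entry by entry (Cohn–Umans 2003, proof of Thm. 2.3: "the coefficient of
`s⁻¹u` in the product is `(AB)_{su}`", here with the group quotients replaced by arbitrary
coordinate maps). [cite: CohnUmans2003, Thm. 2.3] -/
theorem matMulDirectSum_eq_groupTensor_comp {M : Type*} [Monoid M] [DecidableEq M] {p : ℕ}
    (a b c : Fin p → ℕ) (α : (Σ i, Fin (a i) × Fin (b i)) → M)
    (β : (Σ i, Fin (b i) × Fin (c i)) → M) (γ : (Σ i, Fin (a i) × Fin (c i)) → M)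
    (htpp : ∀ x y z, α x * β y = γ z ↔ (z.1 = x.1 ∧ x.1 = y.1 ∧ (z.2.1 : ℕ) = x.2.1 ∧
      (x.2.2 : ℕ) = y.2.1 ∧ (z.2.2 : ℕ) = y.2.2)) :
    matMulDirectSum ℂ a b c = fun z x y => groupTensor ℂ M (γ z) (α x) (β y) := by
  funext z x y
  simp only [matMulDirectSum, groupTensor_apply]
  exact if_congr (htpp x y z).symm rfl rfl

/-- **Monoid-TPP families are restrictions** (settles `stmt-MatrixMultiplication-5973`, exact
route signature `Summit.MatrixMultiplication.MatrixMultiplication.Theses.SemilatticeSTPP.TPPRestriction`):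
in any finite monoid `M`, a family of coordinate maps `α, β, γ` with
`α x · β y = γ z ↔` (same block, `z = (s,u)`, `x = (s,t)`, `y = (t,u)`) exhibits
`matMulDirectSum ℂ a b c ≤ groupTensor ℂ M` — Cohn–Umans 2003, Thm. 2.3 (`⟨n,m,p⟩ ≤ ℂ[G]`) with the
quotient maps `s⁻¹t, t⁻¹u, s⁻¹u` replaced by the given maps; no inverses and no injectivity are
needed because the iff-form is the indicator identity itself. [cite: CohnUmans2003, Thm. 2.3] -/
theorem TPPRestriction_proof :
    Summit.MatrixMultiplication.MatrixMultiplication.Theses.SemilatticeSTPP.TPPRestriction := by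
  unfold Summit.MatrixMultiplication.MatrixMultiplication.Theses.SemilatticeSTPP.TPPRestriction
  intro M _ _ _ p a b c α β γ htpp
  rw [matMulDirectSum_eq_groupTensor_comp a b c α β γ htpp]
  exact tensorRestrictsTo_precomp _ γ α β

end Summit.MatrixMultiplication.MatrixMultiplication.Theorems
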